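import Literature.NumberTheory.Transcendental.KZFibredRelations
import Literature.NumberTheory.Transcendental.KZProductIdeal
import Literature.NumberTheory.Transcendental.KZLogCalculusProofs
import Literature.NumberTheory.Transcendental.SemialgebraicMapsProofs

/-!
# `LogKernelConjecture` (stmt-KontsevichZagierPeriods-2837) — line `spectator-localisation`,
stub `stub_engineAssembly` (E4, assembly of the engine)

The ENGINE of line `spectator-localisation`: if `s : KZ.IntegralRep 1` has `s.value ≠ 0` and the
spectator product `[s] * c` has a FIBRED certificate (`KZ.of s * c ∈ KZ.fibredRelations`, moves
never touching the spectator coordinate `0`), then `c ∈ KZ.relations`. It is assembled here from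
its three ingredients, which enter as hypotheses:
(E1) REWEIGHTING — for a bounded weight `w` with `t ↦ w (t 0)` `ℚ`-semialgebraic on `ℝ¹` an
additive endomorphism `φ` of `KZ.FormalRep`, `[r] ↦ [r_w]` (`r_w`: same domain, integrand
`w (x 0) * f x`), preserving `KZ.fibredRelations`;
(E2) GOOD WEIGHT — a rational box `[a, b] ⊆ s.domain` (`a < b`) and such a weight `w` with
`w (t 0) * g t = (b - a)⁻¹` on the box and `w = 0` off `[a, b]`;
(E3) INTERVAL UNIT — `u = [[a, b], (b - a)⁻¹]` is a unit modulo relations: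
`[u] * c - c ∈ relations`.
Assembly:
(c) `φ ([s] * d) = [s_w] * d` for all `d` (both sides are additive in `d`; on a generator `[t]`,
`[s] * [t] = [s.prod t]` by `KZ.of_mul_of`, and the reweighted twin of `s.prod t` IS `s_w.prod t`:
same product domain, and `w (z 0) * (f ⊗ g) z = ((w f) ⊗ g) z` by
`KZ.IntegralRep.prod_integrand_eq`);
(d) hence `[s_w] * c = φ ([s] * c) ∈ fibredRelations ≤ relations`;
(f) `[s_w] - [u] ∈ relations`: domain additivity `[s_w] = [u] + [s_w | s.domain \ box]` (on the
box `w g = (b - a)⁻¹`), and the second piece has integrand `0` (`w = 0` off `[a, b]`), so it is a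
relation (`KZ.of_mem_relations_of_eqOn_zero`);
(g) `[u] * c = [s_w] * c - ([s_w] - [u]) * c ∈ relations` (right ideal,
`KZ.mul_mem_relations_right_holds`);
(h) `c = [u] * c - ([u] * c - c) ∈ relations` by (E3).
[folklore]
-/

noncomputable section

open MeasureTheory Set
open Literature.NumberTheory.Transcendental

namespace Summit.KontsevichZagierPeriods.LiouvilleUnfolding.SpectatorLocalisation

/-! ## The product formula for the reweighting -/

/-- **Reweighting commutes with spectator products.** If `φ : FormalRep →+ FormalRep` sends every
representation `[r]` of positive dimension `k` to a twin with the same domain and integrand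
`w (x 0) * r.integrand x`, and `s_w` is such a twin of the one-dimensional spectator `s`, then
`φ ([s] * d) = [s_w] * d` for every `d`: both sides are additive in `d`
(`FreeAbelianGroup.lift_ext`), and on a generator `[t]` one has `[s] * [t] = [s.prod t]`
(`KZ.of_mul_of`), whose twin is `s_w.prod t` (`KZ.IntegralRep.ext'`: the product domain only
depends on the domains, and `w (z 0) * (f z' * g z'') = (w (z 0) * f z') * g z''` by
`KZ.IntegralRep.prod_integrand_eq`, `KZ.IntegralRep.prodFun_apply`, the coordinate `0` of
`ℝ¹⁺ᵐ = ℝ¹ × ℝᵐ` being the coordinate `0` of the first factor).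
[cite: KontsevichZagier2001, §4.1] -/
theorem stub_engineAssembly_map_of_mul {w : ℝ → ℝ} (φ : KZ.FormalRep →+ KZ.FormalRep)
    (hφ : ∀ (k : ℕ) (hk : 0 < k) (r : KZ.IntegralRep k), ∃ r' : KZ.IntegralRep k,
      r'.domain = r.domain ∧ (r'.integrand = fun x => w (x ⟨0, hk⟩) * r.integrand x) ∧
      φ (KZ.of r) = KZ.of r')
    {s sw : KZ.IntegralRep 1} (hswd : sw.domain = s.domain)
    (hswi : sw.integrand = fun x => w (x 0) * s.integrand x) (d : KZ.FormalRep) :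
    φ (KZ.of s * d) = KZ.of sw * d := by
  -- on generators
  have key : ∀ (m : ℕ) (t : KZ.IntegralRep m),
      φ (KZ.of s * KZ.of t) = KZ.of sw * KZ.of t := by
    intro m t
    rw [KZ.of_mul_of, KZ.of_mul_of]
    obtain ⟨R, hRd, hRi, hR⟩ := hφ (1 + m) (Nat.add_pos_left Nat.one_pos m) (s.prod t)
    have hR' : R = sw.prod t := by
      refine KZ.IntegralRep.ext' ?_ ?_
      · -- the product domain only depends on the domains of the factors
        rw [hRd]
        ext z
        simp only [KZ.IntegralRep.prod_domain, KZ.IntegralRep.mem_prodDomain, hswd]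
      · -- `w (z 0) * (f z' * g z'') = (w (z' 0) * f z') * g z''`
        rw [hRi, KZ.IntegralRep.prod_integrand_eq, KZ.IntegralRep.prod_integrand_eq]
        funext z
        have h0 : z (Fin.castAdd m (0 : Fin 1)) = z ⟨0, Nat.add_pos_left Nat.one_pos m⟩ :=
          congrArg z (Fin.ext rfl)
        simp only [KZ.IntegralRep.prodFun_apply, hswi, h0, mul_assoc]
    rw [hR, hR']
  -- both sides are additive in `d`
  have h : φ.comp (AddMonoidHom.mulLeft (KZ.of s)) = AddMonoidHom.mulLeft (KZ.of sw) :=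
    FreeAbelianGroup.lift_ext _ _ fun x => key x.1 x.2
  exact DFunLike.congr_fun h d

/-! ## The reweighted spectator is the interval unit modulo relations -/

/-- **`[s_w] - [u] ∈ KZ.relations`.** With the good weight of (E2) — `w (t 0) * g t = (b - a)⁻¹`
on the box `{a ≤ t 0 ≤ b} ⊆ s.domain`, `w = 0` off `[a, b]` — the reweighted spectator
`s_w = [s.domain, w g]` and the interval unit `u = [[a, b], (b - a)⁻¹]` differ by a relation:
domain additivity `[s_w] - [u] - [s_w | s.domain \ box] ∈ KZ.domainAddRel` (the overlap
`box ∩ (s.domain \ box)` is empty, `w g = (b - a)⁻¹` on the box; `KZ.IntegralRep.restrict`), and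
the restriction `[s_w | s.domain \ box]` has integrand `0` on its domain (`w = 0` there), so it is
a relation (`KZ.of_mem_relations_of_eqOn_zero`). [cite: KontsevichZagier2001, §1.2] -/
theorem stub_engineAssembly_of_sub_of_unit_mem_relations {a b : ℚ} {w : ℝ → ℝ}
    {s sw u : KZ.IntegralRep 1}
    (hon : ∀ t : Fin 1 → ℝ, (a : ℝ) ≤ t 0 → t 0 ≤ (b : ℝ) →
      t ∈ s.domain ∧ w (t 0) * s.integrand t = ((b - a : ℚ) : ℝ)⁻¹)
    (hoff : ∀ x : ℝ, (x < (a : ℝ) ∨ (b : ℝ) < x) → w x = 0)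
    (hswd : sw.domain = s.domain) (hswi : sw.integrand = fun x => w (x 0) * s.integrand x)
    (hud : u.domain = {t : Fin 1 → ℝ | (a : ℝ) ≤ t 0 ∧ t 0 ≤ (b : ℝ)})
    (hui : u.integrand = fun _ => ((b - a : ℚ) : ℝ)⁻¹) :
    KZ.of sw - KZ.of u ∈ KZ.relations := by
  -- the box lies in the domain of the spectator
  have hbox : u.domain ⊆ sw.domain := by
    rw [hud, hswd]
    intro t ht
    exact (hon t ht.1 ht.2).1
  -- the junk piece: `s_w` restricted off the box
  obtain ⟨r₂, hr₂d, hr₂i⟩ : ∃ r₂ : KZ.IntegralRep 1,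
      r₂.domain = sw.domain \ u.domain ∧ r₂.integrand = sw.integrand :=
    ⟨sw.restrict (sw.domain \ u.domain) (sw.isSemialgebraic_domain.diff u.isSemialgebraic_domain)
      Set.sdiff_subset, rfl, rfl⟩
  -- domain additivity
  have h1 : KZ.of sw - KZ.of u - KZ.of r₂ ∈ KZ.relations := by
    refine KZ.domainAddRel_subset_relations ⟨1, sw, u, r₂, ?_, ?_, ?_, ?_, rfl⟩
    · rw [hr₂d, Set.union_sdiff_cancel hbox]
    · rw [hr₂d, Set.inter_sdiff_self, measure_empty]
    · intro t ht
      rw [hud] at ht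
      obtain ⟨hat, htb⟩ := ht
      rw [hswi, hui]
      exact (hon t hat htb).2
    · intro t _
      rw [hr₂i]
  -- the junk piece is a relation: its integrand vanishes on its domain
  have h2 : KZ.of r₂ ∈ KZ.relations := by
    refine KZ.of_mem_relations_of_eqOn_zero r₂ fun t ht => ?_
    rw [hr₂d] at ht
    have ht2 : ¬ ((a : ℝ) ≤ t 0 ∧ t 0 ≤ (b : ℝ)) := fun h => ht.2 (by rw [hud]; exact h)
    have hlt : t 0 < (a : ℝ) ∨ (b : ℝ) < t 0 := by
      rcases not_and_or.mp ht2 with h | h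
      · exact Or.inl (not_le.mp h)
      · exact Or.inr (not_le.mp h)
    rw [hr₂i, hswi]
    show w (t 0) * s.integrand t = 0
    rw [hoff _ hlt, zero_mul]
  have h12 : KZ.of sw - KZ.of u = (KZ.of sw - KZ.of u - KZ.of r₂) + KZ.of r₂ :=
    (sub_add_cancel _ _).symm
  rw [h12]
  exact KZ.relations.add_mem h1 h2

/-! ## The stub -/

/-- **Stub E4 — assembly of the engine.** Reweighting (E1) + good weight (E2) + interval unit (E3)
imply that fibred certificates of spectator products cancel: for `s : KZ.IntegralRep 1` with
`s.value ≠ 0` and `[s] * c ∈ KZ.fibredRelations` one has `c ∈ KZ.relations`. With the good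
weight `w` of (E2) and the endomorphism `φ` of (E1):
`[s_w] * c = φ ([s] * c) ∈ fibredRelations ≤ relations` (`stub_engineAssembly_map_of_mul`,
`KZ.fibredRelations_le_relations`); `[s_w] - [u] ∈ relations` for the interval unit
`u = [[a, b], (b - a)⁻¹]` (a representation: the box is `ℚ`-semialgebraic by
`isSemialgebraic_setOf_eval_le`, a rational constant is integrable on it;
`stub_engineAssembly_of_sub_of_unit_mem_relations`); hence
`[u] * c = [s_w] * c - ([s_w] - [u]) * c ∈ relations` (right ideal,
`KZ.mul_mem_relations_right_holds`) and `c = [u] * c - ([u] * c - c) ∈ relations` by (E3).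
[cite: KontsevichZagier2001, §1.2] -/
theorem stub_engineAssembly : (∀ (w : ℝ → ℝ) (M : ℝ), Literature.NumberTheory.Transcendental.IsSemialgebraicFunOn ℚ (Set.univ : Set (Fin 1 → ℝ)) (fun t => w (t 0)) → (∀ x : ℝ, |w x| ≤ M) → ∃ φ : Literature.NumberTheory.Transcendental.KZ.FormalRep →+ Literature.NumberTheory.Transcendental.KZ.FormalRep, (∀ (k : ℕ) (hk : 0 < k) (r : Literature.NumberTheory.Transcendental.KZ.IntegralRep k), ∃ r' : Literature.NumberTheory.Transcendental.KZ.IntegralRep k, r'.domain = r.domain ∧ (r'.integrand = fun x => w (x ⟨0, hk⟩) * r.integrand x) ∧ φ (Literature.NumberTheory.Transcendental.KZ.of r) = Literature.NumberTheory.Transcendental.KZ.of r') ∧ ∀ c ∈ Literature.NumberTheory.Transcendental.KZ.fibredRelations, φ c ∈ Literature.NumberTheory.Transcendental.KZ.fibredRelations) → (∀ (s : Literature.NumberTheory.Transcendental.KZ.IntegralRep 1), s.value ≠ 0 → ∃ (a b : ℚ) (w : ℝ → ℝ) (M : ℝ), a < b ∧ Literature.NumberTheory.Transcendental.IsSemialgebraicFunOn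 ℚ (Set.univ : Set (Fin 1 → ℝ)) (fun t => w (t 0)) ∧ (∀ x : ℝ, |w x| ≤ M) ∧ (∀ t : Fin 1 → ℝ, (a : ℝ) ≤ t 0 → t 0 ≤ (b : ℝ) → t ∈ s.domain ∧ w (t 0) * s.integrand t = ((b - a : ℚ) : ℝ)⁻¹) ∧ (∀ x : ℝ, (x < (a : ℝ) ∨ (b : ℝ) < x) → w x = 0)) → (∀ (a b : ℚ) (u : Literature.NumberTheory.Transcendental.KZ.IntegralRep 1), a < b → u.domain = {t : Fin 1 → ℝ | (a : ℝ) ≤ t 0 ∧ t 0 ≤ (b : ℝ)} → (u.integrand = fun _ => ((b - a : ℚ) : ℝ)⁻¹) → ∀ c : Literature.NumberTheory.Transcendental.KZ.FormalRep, Literature.NumberTheory.Transcendental.KZ.of u * c - c ∈ Literature.NumberTheory.Transcendental.KZ.relations) → ∀ (s : Literature.NumberTheory.Transcendental.KZ.IntegralRep 1) (c : Literature.NumberTheory.Transcendental.KZ.FormalRep), s.value ≠ 0 → Literature.NumberTheory.Transcendental.KZ.of s * c ∈ Literature.NumberTheory.Transcendental.KZ.fibredRelations → c ∈ Literature.NumberTheory.Transcendental.KZ.relations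 := by
  intro hE1 hE2 hE3 s c hs hfib
  -- (a) the good weight and the reweighting endomorphism
  obtain ⟨a, b, w, M, hab, hw, hM, hon, hoff⟩ := hE2 s hs
  obtain ⟨φ, hφ, hφfib⟩ := hE1 w M hw hM
  -- (b) the reweighted spectator
  obtain ⟨sw, hswd, hswi, -⟩ := hφ 1 Nat.one_pos s
  -- (c)-(d) the reweighted certificate is a relation
  have hsw : KZ.of sw * c ∈ KZ.relations := by
    have h := hφfib _ hfib
    rw [stub_engineAssembly_map_of_mul φ hφ hswd hswi c] at h
    exact KZ.fibredRelations_le_relations h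
  -- (e) the interval unit `u = [[a, b], (b - a)⁻¹]`: the box is `ℚ`-semialgebraic (two polynomial
  -- inequalities), the rational constant is a semialgebraic function, and a constant is integrable
  -- on the box, a set of finite Lebesgue measure
  obtain ⟨u, hud, hui⟩ : ∃ u : KZ.IntegralRep 1,
      u.domain = {t : Fin 1 → ℝ | (a : ℝ) ≤ t 0 ∧ t 0 ≤ (b : ℝ)} ∧
      u.integrand = fun _ => ((b - a : ℚ) : ℝ)⁻¹ := by
    have hB : Literature.ModelTheory.ExponentialFields.IsSemialgebraic ℚ
        {t : Fin 1 → ℝ | (a : ℝ) ≤ t 0 ∧ t 0 ≤ (b : ℝ)} := by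
      have h1 := Literature.ModelTheory.ExponentialFields.isSemialgebraic_setOf_eval_le (k := ℚ)
        (R := ℝ) (MvPolynomial.C a : MvPolynomial (Fin 1) ℚ) (MvPolynomial.X 0)
      have h2 := Literature.ModelTheory.ExponentialFields.isSemialgebraic_setOf_eval_le (k := ℚ)
        (R := ℝ) (MvPolynomial.X 0 : MvPolynomial (Fin 1) ℚ) (MvPolynomial.C b)
      simp only [MvPolynomial.aeval_C, MvPolynomial.aeval_X, eq_ratCast] at h1 h2
      exact h1.inter h2
    have hsub : {t : Fin 1 → ℝ | (a : ℝ) ≤ t 0 ∧ t 0 ≤ (b : ℝ)} ⊆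
        Icc (fun _ : Fin 1 => (a : ℝ)) (fun _ => (b : ℝ)) := by
      intro t ht
      simpa only [mem_Icc, Pi.le_def, Fin.forall_fin_one, mem_setOf_eq] using ht
    have hfin : volume (Icc (fun _ : Fin 1 => (a : ℝ)) (fun _ => (b : ℝ))) ≠ ⊤ := by
      rw [Real.volume_Icc_pi, Fin.prod_univ_one]
      exact ENNReal.ofReal_ne_top
    exact ⟨⟨{t : Fin 1 → ℝ | (a : ℝ) ≤ t 0 ∧ t 0 ≤ (b : ℝ)}, fun _ => ((b - a : ℚ) : ℝ)⁻¹, hB,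
      (isSemialgebraicFunOn_aeval hB (MvPolynomial.C (b - a)⁻¹)).congr fun x _ => by simp,
      (integrableOn_const hfin).mono_set hsub⟩, rfl, rfl⟩
  -- (f) the reweighted spectator is the interval unit modulo relations
  have hdiff : KZ.of sw - KZ.of u ∈ KZ.relations :=
    stub_engineAssembly_of_sub_of_unit_mem_relations hon hoff hswd hswi hud hui
  -- (g) right ideal
  have hu : KZ.of u * c ∈ KZ.relations := by
    have h1 : (KZ.of sw - KZ.of u) * c ∈ KZ.relations :=
      KZ.mul_mem_relations_right_holds _ c hdiff
    have h2 : KZ.of u * c = KZ.of sw * c - (KZ.of sw - KZ.of u) * c := by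
      rw [sub_mul, sub_sub_cancel]
    rw [h2]
    exact KZ.relations.sub_mem hsw h1
  -- (h) the unit
  have h3 : KZ.of u * c - c ∈ KZ.relations := hE3 a b u hab hud hui c
  have h4 : c = KZ.of u * c - (KZ.of u * c - c) := (sub_sub_cancel _ _).symm
  rw [h4]
  exact KZ.relations.sub_mem hu h3

end Summit.KontsevichZagierPeriods.LiouvilleUnfolding.SpectatorLocalisation

end
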